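import Summits.AtomisticToContinuum.HydrodynamicLimit.Theses.WarmColdDichotomy
import Literature.MathematicalPhysics.KineticTheory.HardSphereEulerProofs
import Literature.Analysis.FluidPDE.HardSphereAlexander

/-!
Refutation of `WarmColdDichotomy.ColdIsRare` AS FIRST FILED (stmt-AtomisticToContinuum-9236).

Witness: `θe = 1, ℓ = 1/2, α = 1, β = 1/2, R = 1`; then `α · (4/3) π ℓ³ = π/6 ≤ 1`, so for every
configuration and every particle `i` the singleton `S = {i}` is an admissible sub-population of the
ball of `i` with empirical variance `0 ≤ δ² θe` in any unit direction: every particle is COLD, the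
cold fraction is `1 > 1/2`, the event is the whole space, and the homogeneous local Gibbs law is a
probability measure (`isProbabilityMeasure_localGibbsLaw`, `σ ≤ 1/2`), so its mass `1` is not
`≤ exp (-(N+1))`. The hard-sphere flow quantified over exists by Alexander's theorem on the torus
(`HardSphereFlow.nonempty_torus_holds`). The intended statement needs `3 < α · (4/3) π ℓ³`
(sub-populations of ≤ 3 velocities always have a zero-variance direction). [folklore]

**Repair 2026-08-17 (fullbuild breakage "44:18: numerals are data …", six generations of fix items
since 2026-08-15).** The route repair of 2026-08-15T15:11:46Z RESTATED the refuted decl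
`WarmColdDichotomy.ColdIsRare` UNDER THE SAME NAME (stmt-9236 → stmt-AtomisticToContinuum-10103),
inserting exactly the guard `3 < α * (4 / 3 * Real.pi * ℓ ^ 3) →` this refutation demanded; so the
recorded statement `¬ …ColdIsRare` came to denote the repaired (plausibly true) claim, against which the
singleton witness cannot even be instantiated. Theorems files are append-only (a recorded declaration
is neither restated nor removed), so the repair DEPRECATES: the refuted proposition — the ledger
signature of stmt-9236 verbatim — is re-declared as `WarmColdDichotomy.ColdIsRareStmt9236` (a record,
not a route item), the refutation is re-proved against it unchanged as
`WarmColdDichotomyColdIsRareStmt9236_refuted`, and the old name `WarmColdDichotomyColdIsRare_refuted`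
(refuting decl of record of stmt-9236) is kept as a `@[deprecated]` alias of it. Nothing here speaks
about the live item stmt-10103.
-/

open MeasureTheory

namespace Summit.AtomisticToContinuum.HydrodynamicLimit.Theses.WarmColdDichotomy

open scoped BigOperators Classical InnerProductSpace

/-- `ColdIsRare` as route `WarmColdDichotomy` FIRST declared it (item stmt-AtomisticToContinuum-9236,
ledger signature verbatim; restated under the same name as stmt-10103 on 2026-08-15 with the extra
guard `3 < α * (4/3 * π * ℓ^3)`): for small reduced density, under the homogeneous local Gibbs law,
the fraction of COLD particles — those admitting a sub-population `S` of their `ℓ (N+1)^{-1/3}`-ball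
of size `≥ α · (4/3) π ℓ³` whose velocities have empirical variance `≤ δ² θe` in some unit direction —
exceeds `β` only with probability `≤ exp (-R (N+1))`, for every `R`, once `δ ≤ δ₀` and `N ≥ N₀`.
WITHOUT a lower bound on the sub-population size this is false (singletons are admissible when
`α · (4/3) π ℓ³ ≤ 1`): refuted below. Re-declared here (a record, not a route item) only so that the
refutation of record keeps elaborating. -/
def ColdIsRareStmt9236 : Prop :=
  ∃ σ₀ : ℝ, 0 < σ₀ ∧ ∀ σ : ℝ, 0 < σ → σ < σ₀ → ∀ θe : ℝ, 0 < θe → ∀ (ℓ α β : ℝ), 0 < ℓ → 0 < α → 0 < β → ∀ R : ℝ, ∃ δ₀ : ℝ, 0 < δ₀ ∧ ∀ δ : ℝ, 0 < δ → δ ≤ δ₀ → ∃ N₀ : ℕ, ∀ N : ℕ, N₀ ≤ N → ∀ Φ : Literature.Analysis.FluidPDE.HardSphereFlow (Literature.Analysis.FluidPDE.Torus.geometry (Fin 3)) (Literature.MathematicalPhysics.KineticTheory.hsDiameter σ N) (N + 1), Literature.MathematicalPhysics.KineticTheory.localGibbsLaw σ (fun _ => 1) (fun _ => 0) (fun _ =>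 θe) N Φ {z | β < (let tN : ℝ := ((N + 1 : ℕ) : ℝ) ^ (-(1 / 3 : ℝ)); let cold : Literature.Analysis.FluidPDE.Config (N + 1) (Fin 3) Literature.MathematicalPhysics.KineticTheory.T3 → Fin (N + 1) → Prop := fun Z i => ∃ S : Finset (Fin (N + 1)), S ⊆ Finset.univ.filter (fun j => Literature.Analysis.FluidPDE.Torus.euclidDist (Z i).1 (Z j).1 ≤ ℓ * tN) ∧ α * (4 / 3 * Real.pi * ℓ ^ 3) ≤ (S.card : ℝ) ∧ ∃ n : Literature.MathematicalPhysics.KineticTheory.V3, ‖n‖ = 1 ∧ ((S.card : ℝ))⁻¹ * ∑ j ∈ S, (@inner ℝ _ _ n (Z j).2 - ((S.card : ℝ))⁻¹ * ∑ k ∈ S, @inner ℝ _ _ n (Z k).2) ^ 2 ≤ δ ^ 2 * θe; ((N : ℝ) + 1)⁻¹ * ∑ i : Fin (N + 1), @ite ℝ (cold z i) (Classical.propDecidable _) 1 0)} ≤ ENNReal.ofReal (Real.exp (-(R * (N + 1))))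

end Summit.AtomisticToContinuum.HydrodynamicLimit.Theses.WarmColdDichotomy

namespace Summit.AtomisticToContinuum.HydrodynamicLimit.Theorems

/-- Sums of `if p i then 1 else 0` over an everywhere-true predicate count the index set. [folklore] -/
private theorem sum_ite_one_zero_eq_card_of_forall {ι : Type*} (s : Finset ι) (p : ι → Prop)
    (inst : (i : ι) → Decidable (p i)) (h : ∀ i, p i) :
    (∑ i ∈ s, @ite ℝ (p i) (inst i) 1 0) = (s.card : ℝ) := by
  rw [Finset.sum_congr rfl (fun i _ => if_pos (h i))]
  simp

/-- Refutes `WarmColdDichotomy.ColdIsRare` as first filed (stmt-9236, recorded as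
`WarmColdDichotomy.ColdIsRareStmt9236`): with `ℓ = 1/2, α = 1` the size threshold
`α · (4/3) π ℓ³ = π/6 ≤ 1` admits singletons, so every particle is cold and the event has full
(probability-one) measure under the homogeneous local Gibbs law; witness flow from Alexander's
theorem on `𝕋³`. [folklore] -/
theorem WarmColdDichotomyColdIsRareStmt9236_refuted :
    ¬ Summit.AtomisticToContinuum.HydrodynamicLimit.Theses.WarmColdDichotomy.ColdIsRareStmt9236 := by
  rintro ⟨σ₀, hσ₀, H⟩
  -- reduced density: small and positive
  set σ : ℝ := min (σ₀ / 2) (1 / 4) with hσdef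
  have hσpos : 0 < σ := lt_min (by linarith) (by norm_num)
  have hσlt : σ < σ₀ := lt_of_le_of_lt (min_le_left _ _) (by linarith)
  have hσq : σ ≤ 1 / 4 := min_le_right _ _
  have hσhalf : σ ≤ 1 / 2 := by linarith
  -- parameters θe = 1, ℓ = 1/2, α = 1, β = 1/2, R = 1
  obtain ⟨δ₀, hδ₀, H2⟩ := H σ hσpos hσlt 1 one_pos (1 / 2) 1 (1 / 2) (by norm_num) one_pos
    (by norm_num) 1
  obtain ⟨N₀, H3⟩ := H2 δ₀ hδ₀ le_rfl
  -- the flow exists (Alexander)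
  have hbase : (1 : ℝ) ≤ ((N₀ + 1 : ℕ) : ℝ) := by exact_mod_cast Nat.succ_le_succ (Nat.zero_le _)
  have hrpow_le : ((N₀ + 1 : ℕ) : ℝ) ^ (-(1 / 3 : ℝ)) ≤ 1 :=
    Real.rpow_le_one_of_one_le_of_nonpos hbase (by norm_num)
  have hrpow_pos : 0 < ((N₀ + 1 : ℕ) : ℝ) ^ (-(1 / 3 : ℝ)) :=
    Real.rpow_pos_of_pos (by positivity) _
  have hε : 0 < Literature.MathematicalPhysics.KineticTheory.hsDiameter σ N₀ := by
    unfold Literature.MathematicalPhysics.KineticTheory.hsDiameter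
    exact mul_pos hσpos hrpow_pos
  have hε' : Literature.MathematicalPhysics.KineticTheory.hsDiameter σ N₀ < 2⁻¹ := by
    unfold Literature.MathematicalPhysics.KineticTheory.hsDiameter
    calc σ * ((N₀ + 1 : ℕ) : ℝ) ^ (-(1 / 3 : ℝ)) ≤ σ * 1 :=
          mul_le_mul_of_nonneg_left hrpow_le hσpos.le
      _ < 2⁻¹ := by linarith
  obtain ⟨Φ⟩ := Literature.Analysis.FluidPDE.HardSphereFlow.nonempty_torus_holds (d := Fin 3) hε hε'
    (N₀ + 1)
  have H4 := H3 N₀ le_rfl Φ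
  -- the event is everything
  have H5 : Literature.MathematicalPhysics.KineticTheory.localGibbsLaw σ (fun _ => 1) (fun _ => 0)
      (fun _ => 1) N₀ Φ Set.univ ≤ ENNReal.ofReal (Real.exp (-(1 * ((N₀ : ℝ) + 1)))) := by
    refine le_trans (measure_mono fun z _ => ?_) H4
    simp only [Set.mem_setOf_eq]
    rw [sum_ite_one_zero_eq_card_of_forall]
    · rw [Finset.card_univ, Fintype.card_fin, Nat.cast_add_one, inv_mul_cancel₀ (by positivity)]
      norm_num
    · intro i
      refine ⟨{i}, ?_, ?_, EuclideanSpace.single 0 1, ?_, ?_⟩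
      · intro j hj
        rw [Finset.mem_singleton] at hj
        subst hj
        simp only [Finset.mem_filter, Finset.mem_univ, true_and,
          Literature.Analysis.FluidPDE.Torus.euclidDist_self]
        positivity
      · simp only [Finset.card_singleton, Nat.cast_one]
        have := Real.pi_le_four
        nlinarith
      · simp
      · simp only [Finset.card_singleton, Nat.cast_one, inv_one, one_mul, Finset.sum_singleton,
          sub_self, zero_pow two_ne_zero]
        positivity
  -- but the law is a probability measure
  haveI := Literature.MathematicalPhysics.KineticTheory.isProbabilityMeasure_localGibbsLaw
    (a₀ := fun _ => (1 : ℝ)) (θ₀ := fun _ => (1 : ℝ)) (u₀ := fun _ => (0 : Literature.MathematicalPhysics.KineticTheory.V3))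
    continuous_const continuous_const continuous_const (fun _ => one_pos) (fun _ => one_pos)
    hσhalf N₀ Φ
  rw [measure_univ] at H5
  have hlt : ENNReal.ofReal (Real.exp (-(1 * ((N₀ : ℝ) + 1)))) < 1 := by
    rw [ENNReal.ofReal_lt_one]
    rw [Real.exp_lt_one_iff]
    have : (0 : ℝ) < (N₀ : ℝ) + 1 := by positivity
    linarith
  exact absurd H5 (not_le.2 hlt)

/-- **Deprecated record** of the refuting theorem of stmt-AtomisticToContinuum-9236 (formerly
`theorem WarmColdDichotomyColdIsRare_refuted : ¬ WarmColdDichotomy.ColdIsRare`): the route decl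
`ColdIsRare` was restated under the same name (stmt-10103, guarded), so the name is kept as an alias
of the refutation of the original statement (`WarmColdDichotomyColdIsRareStmt9236_refuted`). [folklore] -/
@[deprecated WarmColdDichotomyColdIsRareStmt9236_refuted (since := "2026-08-17")]
alias WarmColdDichotomyColdIsRare_refuted := WarmColdDichotomyColdIsRareStmt9236_refuted

end Summit.AtomisticToContinuum.HydrodynamicLimit.Theorems
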